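import Summits.KontsevichZagierPeriods.KontsevichZagierPeriods.Theses.FurushoPentagon
import Literature.NumberTheory.Transcendental.KZKernelConjectureForms
import Literature.NumberTheory.Transcendental.KZRulesAssociator

/-!
# `ReducedPeriodRing` (stmt-KontsevichZagierPeriods-3929) — logical position and ring forms

The crux `∀ c, c * c ∈ KZ.relations → c ∈ KZ.relations` of route FurushoPentagon, placed exactly:
* it IS reducedness of the formal period ring `P = KZ.FormalPeriodRing`
  (`reducedPeriodRing_iff_isReduced`), i.e. `nilradical P = ⊥`, i.e. `⋂ primes = ⊥`, i.e. prime
  ideals / FIELD-valued realisations `χ : P → K` separate the elements of `P`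
  (`reducedPeriodRing_iff_fieldPoints_separate`) — the form Furusho's transfer consumes;
* the kernel conjecture is injectivity of `evalP : P →+* ℝ` (`kzKernelConjecture_iff_injective_evalP`),
  hence `P` a domain, hence the crux; the summit implies the crux, so a refutation of the crux is
  `¬ KontsevichZagierPeriods` (`not_summit_of_not_reducedPeriodRing`);
* weakening the hypothesis `c * c ∈ relations` to its value `eval c = 0` gives back the summit
  verbatim (`withEvalHyp_iff_summit`); the iterated-square / `xⁿ = 0` forms are equivalent to the
  crux; `route_usage`: under the crux nilpotent classes vanish (what the route needs).
cdisprove (refuter) file; companions `Negative/LoadBearing.lean`, `Negative/PositiveCone.lean`.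
[Kontsevich–Zagier 2001, §1.2, §4.1; Huber–Müller-Stach 2017, §13.2]
-/

noncomputable section

namespace Summit.KontsevichZagierPeriods.KontsevichZagierPeriods.ReducedPeriodRingNegative

open Literature.NumberTheory.Transcendental KZ
open Summit.KontsevichZagierPeriods.KontsevichZagierPeriods.Theses.FurushoPentagon

/-- A square that is a relation evaluates to `0`, hence so does its root:
`eval (c * c) = (eval c)²` (Fubini, `KZ.eval_mul'`) and soundness `KZ.relations_le_ker_eval_holds`.
Every counterexample to the crux therefore lies in `ker eval`. [folklore] -/
theorem eval_eq_zero_of_sq_mem_relations {c : FormalRep} (h : c * c ∈ relations) : eval c = 0 := by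
  have h0 : eval (c * c) = 0 := relations_le_ker_eval_holds h
  rw [eval_mul'] at h0
  exact mul_self_eq_zero.mp h0

/-- **A kill of this crux is a kill of the summit**: the summit is the kernel conjecture
(`kzKernelConjecture_iff_isRational`), which gives `c ∈ relations` from `eval c = 0`
(`eval_eq_zero_of_sq_mem_relations`). (The positive reading "kernel form ⇒ crux" is the route's
support item KernelImpliesReduced, stmt-KontsevichZagierPeriods-11125, not restated here.)
[folklore] -/
theorem not_summit_of_not_reducedPeriodRing (h : ¬ ReducedPeriodRing) : ¬ KontsevichZagierPeriods := by
  intro hs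
  have hK : KZKernelConjecture :=
    kzKernelConjecture_iff_isRational.mpr (KontsevichZagierPeriods_iff.mp hs)
  exact h fun c hc => hK c (eval_eq_zero_of_sq_mem_relations hc)

/-! ### Ring-theoretic reformulations over `P = KZ.FormalPeriodRing = FormalRep ⧸ relations` -/

/-- The crux IS reducedness of the formal period ring `P`. [folklore] -/
theorem reducedPeriodRing_iff_isReduced : ReducedPeriodRing ↔ IsReduced FormalPeriodRing := by
  rw [isReduced_iff_pow_one_lt 2 one_lt_two]
  constructor
  · intro h x hx
    obtain ⟨c, rfl⟩ := toFormalPeriod_surjective x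
    rw [pow_two, ← map_mul, toFormalPeriod_eq_zero_iff] at hx
    exact toFormalPeriod_eq_zero_iff.mpr (h c hx)
  · intro h c hc
    have h1 : toFormalPeriod c ^ 2 = 0 := by
      rw [pow_two, ← map_mul, toFormalPeriod_eq_zero_iff]; exact hc
    exact toFormalPeriod_eq_zero_iff.mp (h _ h1)

/-- A counterexample to the crux is exactly a non-zero square-zero formal period. [folklore] -/
theorem not_reducedPeriodRing_iff_exists_sq_zero :
    ¬ ReducedPeriodRing ↔ ∃ x : FormalPeriodRing, x ≠ 0 ∧ x ^ 2 = 0 := by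
  rw [reducedPeriodRing_iff_isReduced, isReduced_iff_pow_one_lt 2 one_lt_two]
  push Not
  exact ⟨fun ⟨x, hx, hx0⟩ => ⟨x, hx0, hx⟩, fun ⟨x, hx0, hx⟩ => ⟨x, hx, hx0⟩⟩

/-- The crux says the nilradical of `P` vanishes … [folklore] -/
theorem reducedPeriodRing_iff_nilradical_eq_bot :
    ReducedPeriodRing ↔ nilradical FormalPeriodRing = ⊥ := by
  rw [nilradical_eq_bot_iff, reducedPeriodRing_iff_isReduced]

/-- … i.e. the prime ideals of `P` have zero intersection: `P ↪ ∏_𝔭 P/𝔭` — the form in which the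
route's lever `FurushoOverReduced` consumes it. [folklore] -/
theorem reducedPeriodRing_iff_sInf_primes_eq_bot :
    ReducedPeriodRing ↔ sInf {J : Ideal FormalPeriodRing | J.IsPrime} = ⊥ := by
  rw [reducedPeriodRing_iff_nilradical_eq_bot, nilradical_eq_sInf]

/-- The kernel conjecture IS injectivity of `evalP : P →+* ℝ`. [folklore] -/
theorem kzKernelConjecture_iff_injective_evalP :
    KZKernelConjecture ↔ Function.Injective evalP := by
  rw [injective_iff_map_eq_zero]
  constructor
  · intro h x hx
    obtain ⟨c, rfl⟩ := toFormalPeriod_surjective x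
    rw [evalP_toFormalPeriod] at hx
    exact toFormalPeriod_eq_zero_iff.mpr (h c hx)
  · intro h c hc
    exact toFormalPeriod_eq_zero_iff.mp (h _ (by rwa [evalP_toFormalPeriod]))

/-- Under the kernel conjecture `P` is a domain (a subring of `ℝ`). [folklore] -/
theorem isDomain_of_kernel (hK : KZKernelConjecture) : IsDomain FormalPeriodRing :=
  (kzKernelConjecture_iff_injective_evalP.mp hK).isDomain evalP

/-- `P` a domain ⇒ `P` reduced (⇔ the crux, `reducedPeriodRing_iff_isReduced`). This is the
honest logical position: the crux is the shadow "no nilpotents" of "no zero-divisors", itself the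
shadow of injectivity of `evalP`. [folklore] -/
theorem isReduced_of_isDomain (h : IsDomain FormalPeriodRing) : IsReduced FormalPeriodRing :=
  inferInstance

/-- **Weakening the hypothesis to its value gives back the summit**: the crux with `c * c ∈
relations` replaced by its only known consequence `eval c = 0` is VERBATIM the kernel conjecture,
i.e. `KontsevichZagierPeriods` (`kzKernelConjecture_iff_isRational`). So the crux sits strictly
between "trivial" (hypothesis `c ∈ relations`) and the summit; a proof must use the square, not
its value. [folklore] -/
theorem withEvalHyp_iff_summit :
    (∀ c : FormalRep, eval c = 0 → c ∈ relations) ↔ KontsevichZagierPeriods :=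
  (kzKernelConjecture_iff_isRational).trans KontsevichZagierPeriods_iff.symm

/-- Iterated form: the crux is `x ^ n = 0 → x = 0` in `P` for every `n` (so the natural
strengthening to higher / iterated powers is not stronger). [folklore] -/
theorem reducedPeriodRing_iff_pow :
    ReducedPeriodRing ↔ ∀ (x : FormalPeriodRing) (n : ℕ), x ^ n = 0 → x = 0 := by
  rw [reducedPeriodRing_iff_isReduced]
  exact ⟨fun h x n hx => h.eq_zero x ⟨n, hx⟩, fun h => ⟨fun x ⟨n, hx⟩ => h x n hx⟩⟩

/-- What the route ACTUALLY consumes (Furusho's theorem over the residue fields of `P_ℚ` puts each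
double-shuffle defect `d` in every prime, i.e. makes it nilpotent): nilpotent classes vanish. This is
literally `IsReduced P`, i.e. the crux — no weaker global statement does the job, but only the
defects `d` in the MZV subring are ever fed to it. -/
theorem route_usage (h : ReducedPeriodRing) {c : FormalRep} (hn : IsNilpotent (toFormalPeriod c)) :
    c ∈ relations :=
  toFormalPeriod_eq_zero_iff.mp ((reducedPeriodRing_iff_isReduced.mp h).eq_zero _ hn)

section Points

/-- The crux ⇔ prime ideals separate the elements of `P`. [folklore] -/
theorem reducedPeriodRing_iff_primes_separate :
    ReducedPeriodRing ↔ ∀ x : FormalPeriodRing, x ≠ 0 →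
      ∃ J : Ideal FormalPeriodRing, J.IsPrime ∧ x ∉ J := by
  rw [reducedPeriodRing_iff_isReduced]
  constructor
  · intro h x hx
    by_contra hcon
    push Not at hcon
    exact hx (h.eq_zero x (nilpotent_iff_mem_prime.mpr hcon))
  · intro h
    refine ⟨fun x hx => ?_⟩
    by_contra hne
    obtain ⟨J, hJ, hxJ⟩ := h x hne
    exact hxJ (nilpotent_iff_mem_prime.mp hx J hJ)

/-- **Realisation form of the crux**: `P` is reduced iff ring homomorphisms to fields separate its
elements. (→: `x ∉ 𝔭`, then `P → P/𝔭 → Frac(P/𝔭)`; ←: the image of a nilpotent in a field is `0`.)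
[folklore] -/
theorem reducedPeriodRing_iff_fieldPoints_separate :
    ReducedPeriodRing ↔ ∀ x : FormalPeriodRing, x ≠ 0 →
      ∃ (K : Type) (_ : Field K) (χ : FormalPeriodRing →+* K), χ x ≠ 0 := by
  constructor
  · intro h x hx
    obtain ⟨J, hJ, hxJ⟩ := (reducedPeriodRing_iff_primes_separate.mp h) x hx
    haveI : J.IsPrime := hJ
    refine ⟨FractionRing (FormalPeriodRing ⧸ J), inferInstance,
      (algebraMap (FormalPeriodRing ⧸ J) (FractionRing (FormalPeriodRing ⧸ J))).comp
        (Ideal.Quotient.mk J), ?_⟩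
    rw [RingHom.comp_apply, Ne, ← map_zero (algebraMap (FormalPeriodRing ⧸ J) (FractionRing (FormalPeriodRing ⧸ J))),
      (IsFractionRing.injective (FormalPeriodRing ⧸ J) (FractionRing (FormalPeriodRing ⧸ J))).eq_iff,
      Ideal.Quotient.eq_zero_iff_mem]
    exact hxJ
  · intro h
    rw [reducedPeriodRing_iff_isReduced]
    refine ⟨fun x hx => ?_⟩
    by_contra hne
    obtain ⟨K, _, χ, hχ⟩ := h x hne
    exact hχ ((hx.map χ).eq_zero)

end Points

end Summit.KontsevichZagierPeriods.KontsevichZagierPeriods.ReducedPeriodRingNegative
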